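import Summits.QuantumFields.BalabanUV.Beta.D1BFx.GhostWardTransversal
import Summits.QuantumFields.BalabanUV.Beta.D1BFx.TwoBondWardPairingJoint
import Summits.QuantumFields.BalabanUV.Beta.D1BFx.PackedWordPairing
import Summits.QuantumFields.BalabanUV.Beta.D1BFx.GhostKernelComplete

/-!
# `BalabanUV.Beta.D1BFx.GhostWardWord` — road «BF-x» for binder row D1, slot (K), junction (J3), brick (B2) SECOND HALF, ASSEMBLY:
# **«GHOST WARD AT U = 1 — TRANSVERSALITY» AT THE LEVEL OF THE ONE-LOOP WORD** — for the completed ghost data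
# `(Ggh (m+1) a, SghAt ρ (m+1) (c(m+1)²) (ca), WghAt ρ (m+1) (−c) (c(m+1)²) (ca))` the one-loop word `hessKer` of the leg at the stencils ∕ tables
# PACKED WITH THE ROAD's CO-DRESSED WEIGHTS `colH G₀ (m+1)` (`G₀ = coDressKBmAt (toSite r) (m+1) K₀`) EQUALS the word packed with the UNDRESSED
# weights `colH K₀ (m+1)` (`K₀ = KInvStep (m+1) 0`): the axial block-mean dressing is INVISIBLE on the full ghost word; the undressed word IS
# the typer's `TOfGh (m+1) a Sgh (tableRedF (m+1) Wgh)` (`colH K₀ = wH`), so AT THE CENTRED STENCIL ROOT THE CO-DRESSED COMPLETED GHOST WORD IS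
# THE END's `GhostKernelComplete.PghQ (m+1) a (−c) (c(m+1)²) (ca)` — the (J3) repair target «(Ward) dressed = undressed = `PghQ` on the ray».

Stated FIRST for ANY localised triple `(A, S, W)` whose fine Hessian has divergence-free rows in each bond (`word_dressed_eq_undressed` — road owner
d1-p2 g20 W-1's preferred, table-generic form), THEN at the ghost data.  ASSEMBLY BY NAME of this lineage's generic cores and the instance: `PackedWordPairing.hessKer_packed_eq_joint_pairing` (word = joint pairing of
the fine Hessian with the weights), `TwoBondWardPairingJoint.iterated_eq_joint` (joint = iterated), `GhostWardTransversal.fineHessA_pairing_dressed_eq_undressed` over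
`TwoBondWardPairingRoad.road_pairing_dressed_eq_undressed` (iterated pairing: dressed = undressed, from `TwoBondWardPairing.pairing_grad_shift_invariant`
+ the fine Ward rows + «G0-COL-ENV»).  New letters typed
here: the `ℓ¹` weight shape of the UNDRESSED column (`abs_colH_K₀_road_le_l1`, from `PackedColumnEnvelope.abs_colH_KInvStep_zero_le` + `env_le_exp_l1`),
the separate decay of the tadpole ∕ bubble halves of the ghost fine Hessian, the joint summabilities they feed, and (§4) the identification
of the `colH K₀`-packing with the typer's `wH`-packing (`colH_K₀_eq_wH`, `sum_wsum_colH_K₀_eq_vertexRedF`, `sum_wsum_wsum_colH_K₀_eq_tableRedF`,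
`hessKer_K₀_packed_eq_TOfGh`) and the corollary `ghost_word_dressed_eq_PghQ` at the centred root `ctrHalf (m+1)`.

HONEST DEPENDENCY (cell records, verbatim): «continuum YM on T⁴ ⇐ BetaPertH ∧ nine spine estimates (0/9 proved); BetaPertH ⇐ (D1) ∧ (D4) ∧
CAP+tail; G-an2-4 gates asym, D1 and NE2/3/4.»  HONEST FRAMING (cell contract, verbatim): «discharging `BetaPertH` makes Bałaban's UV stability
UNCONDITIONAL — a real constructive-QFT result; it is NOT the continuum limit and NOT the Clay problem.»  THIS MODULE DISCHARGES NOTHING of the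
wall: [folklore] composition BY NAME + `tsum` bookkeeping over OUR objects; (J3) remains DISPLAYED until the road's PART 11′ consumes this; no
definition, no `def … : Prop`, no notation, nothing cited, 0 sorry.  0 root-level binders of row D1 discharged (hW ∕ hR-sockets ∕ hSX-socket ∕ D1Tel ∕
D1Rep — 0); (K) NOT closed; NOT D1, NOT `BetaPertH`, NOT continuum, NOT Clay.

ABSOLUTE RULE (cell charter, verbatim): «No internally-minted statement may enter as a cited fact. Every hypothesis is either kernel-proved in
this package or a verbatim quotation of a PUBLISHED theorem with page reference. The manuscript(s) under audit are NOT citable for their own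
disputed steps — they are the thing under adjudication; programme-internal (2001/route/tribunal) claims are never citable.»

Unit `b2b-balaban-beta-d1-formalise-leaf-04` (gen 21), D1 formalisation swarm leaf prover 04, road «BF-x»; (B2) second half per R-D1-g40-1 ∕ ρ-g19-4 (journal).
-/

noncomputable section

open Finset
open scoped BigOperators
open Literature.MathematicalPhysics.QuantumFieldTheory
open Literature.MathematicalPhysics.QuantumFieldTheory.Balaban1983to89
open Literature.MathematicalPhysics.QuantumFieldTheory.Balaban1983to89.Beta
open B12Sec2to5 (l1 l1_nonneg)
open B5Hk163Strip (kappa163 kappa163_pos)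
open B5Hk163Decay (MG163)
open B4TorusKernel (periodConst)
open B5Kernel166Decay (periodConst_pos)
open ExpKernelCalculus (Site MKer BiLoc hessKer bubble tadpole)
open Summit.QuantumFields.BalabanUV.Beta.TameKernelCalculus (Spr)
open AffineAveraging (box toSite unitVec)
open KernelSpecInstance (wH)
open OneStepKernelFamily (KInvStep colH)
open OneStepResolventKernel (wsum KInv_inl_inr_coarse)
open Summit.QuantumFields.BalabanUV.Beta.BorderedHessian (KInvStep_zero_eq)
open Summit.QuantumFields.BalabanUV.Beta.AxialDressingRooted (coDressKBmAt)
open Summit.QuantumFields.BalabanUV.Beta.GAN24.EnvelopeBlockSum (env_le_exp_l1)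
open Summit.QuantumFields.BalabanUV.Beta.D1BFx.MomentTransferPeriodic (baseKer)
open Summit.QuantumFields.BalabanUV.Beta.D1BFx.GhostLeg (Ggh spr_Ggh)
open Summit.QuantumFields.BalabanUV.Beta.D1BFx.GhostStencilRooted (SghAt biLoc_SghAt)
open Summit.QuantumFields.BalabanUV.Beta.D1BFx.GhostAveragingSquare (WghAt biLoc_WghAt)
open Summit.QuantumFields.BalabanUV.Beta.D1BFx.ReducedKernelSandwichLeg (fineHessA)
open Summit.QuantumFields.BalabanUV.Beta.D1BFx.DressedTablesLeg (tadpoleTableA_apply bubbleTableA_apply exists_decay_bubbleTableA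
  exists_decay_tadpoleTableA vertexRedF_eq_sum_wsum tableRedF_eq_sum_wsum)
open Summit.QuantumFields.BalabanUV.Beta.D1BFx.ReducedKernelF (vertexRedF TOfGh TOfGh_eq)
open Summit.QuantumFields.BalabanUV.Beta.D1BFx.ReducedTableF (tableRedF)
open Summit.QuantumFields.BalabanUV.Beta.D1BFx.GhostStencilRootedReflection (ctrHalf ctrHalf_mem)
open Summit.QuantumFields.BalabanUV.Beta.D1BFx.GhostKernelComplete (PghQ PghQ_eq)
open Summit.QuantumFields.BalabanUV.Beta.D1BFx.PackedColumnEnvelope (abs_colH_KInvStep_zero_le abs_colH_G₀_road_le colH_G₀_road_weight_nonneg)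
open Summit.QuantumFields.BalabanUV.Beta.D1BFx.TwoBondWardPairingJoint (summable_prod_slice iterated_eq_joint)
open Summit.QuantumFields.BalabanUV.Beta.D1BFx.PackedWordPairing (hessKer_packed_eq_joint_pairing)
open Summit.QuantumFields.BalabanUV.Beta.D1BFx.TwoBondWardPairingRoad (abs_colH_K₀_le)
open Summit.QuantumFields.BalabanUV.Beta.D1BFx.GhostWardTransversal (exists_decay_fineHessA fineHessA_pairing_dressed_eq_undressed divFree₁_ghostHess
  divFree₂_ghostHess)

namespace Summit.QuantumFields.BalabanUV.Beta.D1BFx.GhostWardWord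

/-! ## §1 The two halves of the fine Hessian of a localised triple decay off the diagonal, separately -/

section Decay

variable {F : Type*} [Fintype F] [Nonempty F] {A : MKer 4 F} {S : Fin 4 → Site 4 → MKer 4 F}
  {W : Fin 4 → Site 4 → Fin 4 → Site 4 → MKer 4 F} {Cs C2 δ : ℝ}

/-- [folklore] **TADPOLE HALF**: `∃ C δ′ > 0, |tadpole A (W κ u l u′)| ≤ C·e^{−δ′|u − u′|₁}` (`DressedTablesLeg.exists_decay_tadpoleTableA`, ×2). -/
theorem exists_decay_tadpole_of_biLoc (hA : Spr A) (hW : ∀ κ u l u', BiLoc (W κ u l u') u u' C2 δ) (hδ : 0 < δ) :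
    ∃ C δ' : ℝ, 0 < δ' ∧ ∀ (κ l : Fin 4) (u u' : Site 4), |tadpole A (W κ u l u')| ≤ C * Real.exp (-δ' * l1 (u - u')) := by
  obtain ⟨C₁, δ₁, hδ₁, h₁⟩ := exists_decay_tadpoleTableA (A := A) (Wf := W) hA hW hδ
  refine ⟨2 * C₁, δ₁, hδ₁, fun κ l u u' => ?_⟩
  have e : u = u' + (u - u') := by abel
  have k := h₁ κ l u' (u - u')
  rw [baseKer, ← e, tadpoleTableA_apply, abs_mul, abs_of_pos (by norm_num : (0 : ℝ) < 1 / 2)] at k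
  linarith

omit [Nonempty F] in
/-- [folklore] **BUBBLE HALF**: `∃ C δ′ > 0, |bubble A (S κ u) (S l u′)| ≤ C·e^{−δ′|u − u′|₁}` (`DressedTablesLeg.exists_decay_bubbleTableA`, ×2). -/
theorem exists_decay_bubble_of_biLoc (hA : Spr A) (hS : ∀ κ u, BiLoc (S κ u) u u Cs δ) (hδ : 0 < δ) :
    ∃ C δ' : ℝ, 0 < δ' ∧ ∀ (κ l : Fin 4) (u u' : Site 4), |bubble A (S κ u) (S l u')| ≤ C * Real.exp (-δ' * l1 (u - u')) := by
  obtain ⟨C₂, δ₂, hδ₂, h₂⟩ := exists_decay_bubbleTableA (A := A) (S := S) hA hS hδ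
  refine ⟨2 * C₂, δ₂, hδ₂, fun κ l u u' => ?_⟩
  have e : u = u' + (u - u') := by abel
  have k := h₂ κ l u' (u - u')
  rw [baseKer, ← e, bubbleTableA_apply, abs_mul, abs_neg, abs_of_pos (by norm_num : (0 : ℝ) < 1 / 2)] at k
  linarith

/-- [folklore] **JOINT SUMMABILITY OF THE PACKED TADPOLE ∕ BUBBLE FAMILIES** for a bounded first weight and an `ℓ¹`-decaying second weight
(`TwoBondWardPairingJoint.summable_prod_slice` at the two halves' decay): the `hsum` slots of `PackedWordPairing.hessKer_packed_eq_joint_pairing`. -/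
theorem summable_joint_of_biLoc (hA : Spr A) (hS : ∀ κ u, BiLoc (S κ u) u u Cs δ) (hW : ∀ κ u l u', BiLoc (W κ u l u') u u' C2 δ)
    (hδ : 0 < δ) {w₁ w₂ : Site 4 → ℝ} {B₁ C₂' δ₂ : ℝ} {p : Site 4} (hw₁ : ∀ u, |w₁ u| ≤ B₁)
    (hw₂ : ∀ u', |w₂ u'| ≤ C₂' * Real.exp (-δ₂ * l1 (u' - p))) (hδ₂ : 0 < δ₂) (κ l : Fin 4) :
    (Summable fun q : Site 4 × Site 4 => w₁ q.1 * w₂ q.2 * tadpole A (W κ q.1 l q.2))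
    ∧ (Summable fun q : Site 4 × Site 4 => w₁ q.1 * w₂ q.2 * bubble A (S κ q.1) (S l q.2)) := by
  obtain ⟨CT, δT, hδT, hT⟩ := exists_decay_tadpole_of_biLoc hA hW hδ
  obtain ⟨CB, δB, hδB, hB⟩ := exists_decay_bubble_of_biLoc hA hS hδ
  exact ⟨summable_prod_slice (H := fun u u' => tadpole A (W κ u l u')) hw₁ hw₂ hδ₂ (fun u u' => hT κ l u u') hδT,
    summable_prod_slice (H := fun u u' => bubble A (S κ u) (S l u')) hw₁ hw₂ hδ₂ (fun u u' => hB κ l u u') hδB⟩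

end Decay

/-! ## §2 The UNDRESSED column in the fine `ℓ¹` weight shape (the road's `d = 3`, block side `m + 1`) -/

/-- [folklore] **THE UNDRESSED ℋ-COLUMN IN THE `ℓ¹` CURRENCY**: `|colH K₀ (m+1) μ y κ u| ≤ ((m+1)⁵)⁻¹·C₄·e^{κ′}·e^{−(κ′∕(4(m+1)))·|u − (m+1)•y|₁}`,
`C₄ = MG163 4·periodConst (kappa163 4) 3`, `κ′ = kappa163 4 ∕ 4` (`abs_colH_KInvStep_zero_le` + `EnvelopeBlockSum.env_le_exp_l1`). -/
theorem abs_colH_K₀_road_le_l1 (m : ℕ) (μ : Fin 4) (y : Site 4) (κ : Fin 4) (u : Site 4) :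
    |colH (KInvStep (d := 3) (m + 1) 0) (m + 1) μ y κ u|
      ≤ ((((m + 1 : ℕ) : ℝ) ^ 5)⁻¹ * (MG163 4 * periodConst (kappa163 4) 3) * Real.exp (kappa163 4 / 4))
        * Real.exp (-(kappa163 4 / 4 / (4 * ((m + 1 : ℕ) : ℝ))) * l1 (u - ((m + 1 : ℕ) : ℤ) • y)) := by
  have hN : 1 ≤ m + 1 := Nat.le_add_left 1 m
  have h := abs_colH_KInvStep_zero_le (d := 3) (N := m + 1) hN μ y κ u
  have hc : 0 ≤ kappa163 (3 + 1) / ((3 : ℝ) + 1) := div_nonneg (kappa163_pos _).le (by positivity)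
  have hM : 0 ≤ (((m + 1 : ℕ) : ℝ) ^ (3 + 2))⁻¹ * (MG163 (3 + 1) * periodConst (kappa163 (3 + 1)) 3) :=
    (mul_nonneg_iff_of_pos_right (Real.exp_pos _)).1 ((abs_nonneg _).trans h)
  have he := env_le_exp_l1 (d := 3) hN hc y u
  refine (h.trans (mul_le_mul_of_nonneg_left he hM)).trans_eq ?_
  have e1 : (3 : ℕ) + 1 = 4 := rfl
  have e2 : (3 : ℕ) + 2 = 5 := rfl
  have e3 : ((3 : ℕ) : ℝ) + 1 = 4 := by norm_num
  have e4 : (3 : ℝ) + 1 = 4 := by norm_num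
  simp only [e1, e2, e3, e4]
  ring

/-- [folklore] The undressed weight constant is nonnegative. -/
theorem colH_K₀_road_weight_nonneg (m : ℕ) :
    0 ≤ (((m + 1 : ℕ) : ℝ) ^ 5)⁻¹ * (MG163 4 * periodConst (kappa163 4) 3) * Real.exp (kappa163 4 / 4) := by
  have h := abs_colH_K₀_road_le_l1 m 0 0 0 0
  exact (mul_nonneg_iff_of_pos_right (Real.exp_pos _)).1 ((abs_nonneg _).trans h)

/-- [folklore] The road's weight rate `κ′∕(4(m+1))` is positive. -/
theorem road_rate_pos (m : ℕ) : 0 < kappa163 4 / 4 / (4 * ((m + 1 : ℕ) : ℝ)) := by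
  have h1 := kappa163_pos 4
  have h2 : (0 : ℝ) < ((m + 1 : ℕ) : ℝ) := by exact_mod_cast Nat.succ_pos m
  positivity

/-- [folklore] The co-dressed column is bounded (drop the exponential of «G0-COL-ENV»). -/
theorem abs_colH_G₀_road_bdd (m : ℕ) {r : Fin (3 + 1) → ℕ} (hr : r ∈ box (3 + 1) (m + 1)) (μ : Fin 4) (y : Site 4) (κ : Fin 4) (u : Site 4) :
    |colH (coDressKBmAt (toSite r) (m + 1) (KInvStep (d := 3) (m + 1) 0)) (m + 1) μ y κ u|
      ≤ (((m + 1 : ℕ) : ℝ) ^ 4)⁻¹ * ((MG163 4 * periodConst (kappa163 4) 3)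
          * (1 + 8 * (1 + Real.exp (kappa163 4 / 4))) * Real.exp (kappa163 4 / 4)) := by
  refine (abs_colH_G₀_road_le m hr μ y κ u).trans (mul_le_of_le_one_right (colH_G₀_road_weight_nonneg m) ?_)
  rw [Real.exp_le_one_iff, neg_mul, neg_nonpos]
  exact mul_nonneg (road_rate_pos m).le (l1_nonneg _)

/-! ## §3 The word: dressed = undressed — generic localised triple with fine Ward rows, then the ghost instance -/

section MainGeneric

variable (m : ℕ) {r : Fin (3 + 1) → ℕ} (hr : r ∈ box (3 + 1) (m + 1))
  {F : Type*} [Fintype F] [Nonempty F] {A : MKer 4 F} {S : Fin 4 → Site 4 → MKer 4 F}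
  {W : Fin 4 → Site 4 → Fin 4 → Site 4 → MKer 4 F} {Cs C2 δ : ℝ}
include hr

/-- [folklore] **THE ROAD's CO-DRESSING OF THE WEIGHTS IS INVISIBLE ON THE ONE-LOOP WORD OF ANY LOCALISED TRIPLE WITH FINE WARD ROWS**
(road owner d1-p2 g20 W-1's preferred form): for a spread leg `A`, localised stencils `S` and table `W` (one rate `δ > 0`) whose fine Hessian
`H := fineHessA A S W` has divergence-free rows in each bond, with `G₀ = coDressKBmAt (toSite r) (m+1) K₀`, `K₀ = KInvStep (m+1) 0`, any in-block `r`: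
`hessKer A (μ y ↦ Σ_κ wsum (colH G₀ μ y κ) (S κ)) (μ y ν y′ ↦ Σ_κ Σ_l wsum (colH G₀ μ y κ) (u ↦ wsum (colH G₀ ν y′ l) (W κ u l))) μ ν z`
`= hessKer A (μ y ↦ Σ_κ wsum (colH K₀ μ y κ) (S κ)) (μ y ν y′ ↦ Σ_κ Σ_l wsum (colH K₀ μ y κ) (u ↦ wsum (colH K₀ ν y′ l) (W κ u l))) μ ν z`
— word → joint pairing (`PackedWordPairing.hessKer_packed_eq_joint_pairing`, both sides) → iterated pairing (`TwoBondWardPairingJoint.iterated_eq_joint`,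
both sides) → `GhostWardTransversal.fineHessA_pairing_dressed_eq_undressed`. -/
theorem word_dressed_eq_undressed (hA : Spr A) (hS : ∀ κ u, BiLoc (S κ u) u u Cs δ) (hW : ∀ κ u l u', BiLoc (W κ u l u') u u' C2 δ)
    (hδ : 0 < δ)
    (hdiv₁ : ∀ (l : Fin 4) (u' u : Site 4), ∑ κ : Fin 4, (fineHessA A S W κ l u u' - fineHessA A S W κ l (u - unitVec κ) u') = 0)
    (hdiv₂ : ∀ (κ : Fin 4) (u u' : Site 4), ∑ l : Fin 4, (fineHessA A S W κ l u u' - fineHessA A S W κ l u (u' - unitVec l)) = 0)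
    (μ ν : Fin 4) (z : Site 4) :
    hessKer A (fun μ y => ∑ κ : Fin 4, wsum (colH (coDressKBmAt (toSite r) (m + 1) (KInvStep (d := 3) (m + 1) 0)) (m + 1) μ y κ) (S κ))
        (fun μ y ν y' => ∑ κ : Fin 4, ∑ l : Fin 4, wsum (colH (coDressKBmAt (toSite r) (m + 1) (KInvStep (d := 3) (m + 1) 0)) (m + 1) μ y κ) (fun u => wsum (colH (coDressKBmAt (toSite r) (m + 1) (KInvStep (d := 3) (m + 1) 0)) (m + 1) ν y' l) (W κ u l))) μ ν z
      = hessKer A (fun μ y => ∑ κ : Fin 4, wsum (colH (KInvStep (d := 3) (m + 1) 0) (m + 1) μ y κ) (S κ))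
          (fun μ y ν y' => ∑ κ : Fin 4, ∑ l : Fin 4, wsum (colH (KInvStep (d := 3) (m + 1) 0) (m + 1) μ y κ) (fun u => wsum (colH (KInvStep (d := 3) (m + 1) 0) (m + 1) ν y' l) (W κ u l))) μ ν z := by
  -- the two weight families in the `ℓ¹` shape, centred at `(m+1)•y`
  have hwG : ∀ (μ : Fin 4) (y : Site 4) (κ : Fin 4) (u : Site 4), |colH (coDressKBmAt (toSite r) (m + 1) (KInvStep (d := 3) (m + 1) 0)) (m + 1) μ y κ u|
        ≤ ((((m + 1 : ℕ) : ℝ) ^ 4)⁻¹ * ((MG163 4 * periodConst (kappa163 4) 3)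
            * (1 + 8 * (1 + Real.exp (kappa163 4 / 4))) * Real.exp (kappa163 4 / 4)))
          * Real.exp (-(kappa163 4 / 4 / (4 * ((m + 1 : ℕ) : ℝ))) * l1 (u - (fun (_ : Fin 4) (y : Site 4) => ((m + 1 : ℕ) : ℤ) • y) μ y)) :=
    fun μ y κ u => abs_colH_G₀_road_le m hr μ y κ u
  have hwK : ∀ (μ : Fin 4) (y : Site 4) (κ : Fin 4) (u : Site 4), |colH (KInvStep (d := 3) (m + 1) 0) (m + 1) μ y κ u|
        ≤ ((((m + 1 : ℕ) : ℝ) ^ 5)⁻¹ * (MG163 4 * periodConst (kappa163 4) 3) * Real.exp (kappa163 4 / 4))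
          * Real.exp (-(kappa163 4 / 4 / (4 * ((m + 1 : ℕ) : ℝ))) * l1 (u - (fun (_ : Fin 4) (y : Site 4) => ((m + 1 : ℕ) : ℤ) • y) μ y)) :=
    fun μ y κ u => abs_colH_K₀_road_le_l1 m μ y κ u
  have hcr := road_rate_pos m
  obtain ⟨C, δ', hδ', hH⟩ := exists_decay_fineHessA hA hS hW hδ
  -- word = joint pairing, on both sides
  rw [hessKer_packed_eq_joint_pairing hA hS hW hδ hwG (colH_G₀_road_weight_nonneg m) hcr μ ν z
      (fun κ l => (summable_joint_of_biLoc hA hS hW hδ (fun u => abs_colH_G₀_road_bdd m hr μ 0 κ u) (fun u' => hwG ν z l u') hcr κ l).1)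
      (fun κ l => (summable_joint_of_biLoc hA hS hW hδ (fun u => abs_colH_G₀_road_bdd m hr μ 0 κ u) (fun u' => hwG ν z l u') hcr κ l).2),
    hessKer_packed_eq_joint_pairing hA hS hW hδ hwK (colH_K₀_road_weight_nonneg m) hcr μ ν z
      (fun κ l => (summable_joint_of_biLoc hA hS hW hδ (fun u => abs_colH_K₀_le (m + 1) μ 0 κ u) (fun u' => hwK ν z l u') hcr κ l).1)
      (fun κ l => (summable_joint_of_biLoc hA hS hW hδ (fun u => abs_colH_K₀_le (m + 1) μ 0 κ u) (fun u' => hwK ν z l u') hcr κ l).2)]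
  -- joint = iterated, on both sides; then the pairing identity
  have eG := iterated_eq_joint (w₁ := colH (coDressKBmAt (toSite r) (m + 1) (KInvStep (d := 3) (m + 1) 0)) (m + 1) μ 0) (w₂ := colH (coDressKBmAt (toSite r) (m + 1) (KInvStep (d := 3) (m + 1) 0)) (m + 1) ν z) (H := fineHessA A S W)
    (fun κ u => abs_colH_G₀_road_bdd m hr μ 0 κ u) (fun l u' => hwG ν z l u') hcr hH hδ'
  have eK := iterated_eq_joint (w₁ := colH (KInvStep (d := 3) (m + 1) 0) (m + 1) μ 0) (w₂ := colH (KInvStep (d := 3) (m + 1) 0) (m + 1) ν z) (H := fineHessA A S W)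
    (fun κ u => abs_colH_K₀_le (m + 1) μ 0 κ u) (fun l u' => hwK ν z l u') hcr hH hδ'
  rw [← eG, ← eK]
  exact fineHessA_pairing_dressed_eq_undressed m hr hA hS hW hδ hdiv₁ hdiv₂ μ 0 ν z

end MainGeneric

section Main

variable (m : ℕ) {r : Fin (3 + 1) → ℕ} (hr : r ∈ box (3 + 1) (m + 1)) {a : ℝ} (ha : 0 < a) {ρ : Site 4}
  (hρ : ∀ i : Fin 4, 0 ≤ ρ i ∧ ρ i < (m + 1 : ℕ)) (c : ℝ)
include hr ha hρ

/-- [folklore] **«GHOST WARD AT U = 1 — TRANSVERSALITY» FOR THE ONE-LOOP GHOST WORD**: with `G₀ = coDressKBmAt (toSite r) (m+1) K₀`, `K₀ = KInvStep (m+1) 0`,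
`Sgh = SghAt ρ (m+1) (c(m+1)²) (ca)`, `Wgh = WghAt ρ (m+1) (−c) (c(m+1)²) (ca)` (any in-block stencil root `ρ`, any dressing root `r`, any real `c`),
`hessKer Ggh (μ y ↦ Σ_κ wsum (colH G₀ μ y κ) (Sgh κ)) (μ y ν y′ ↦ Σ_κ Σ_l wsum (colH G₀ μ y κ) (u ↦ wsum (colH G₀ ν y′ l) (Wgh κ u l))) μ ν z`
`= hessKer Ggh (μ y ↦ Σ_κ wsum (colH K₀ μ y κ) (Sgh κ)) (μ y ν y′ ↦ Σ_κ Σ_l wsum (colH K₀ μ y κ) (u ↦ wsum (colH K₀ ν y′ l) (Wgh κ u l))) μ ν z`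
(the generic theorem at `spr_Ggh`, `biLoc_SghAt`, `biLoc_WghAt` and `GhostWardTransversal.divFree₁∕₂_ghostHess`). -/
theorem ghost_word_dressed_eq_undressed (μ ν : Fin 4) (z : Site 4) :
    hessKer (Ggh (m + 1) a)
        (fun μ y => ∑ κ : Fin 4, wsum (colH (coDressKBmAt (toSite r) (m + 1) (KInvStep (d := 3) (m + 1) 0)) (m + 1) μ y κ)
          (SghAt ρ (m + 1) (c * ((m + 1 : ℕ) : ℝ) ^ 2) (c * a) κ))
        (fun μ y ν y' => ∑ κ : Fin 4, ∑ l : Fin 4,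
          wsum (colH (coDressKBmAt (toSite r) (m + 1) (KInvStep (d := 3) (m + 1) 0)) (m + 1) μ y κ)
            (fun u => wsum (colH (coDressKBmAt (toSite r) (m + 1) (KInvStep (d := 3) (m + 1) 0)) (m + 1) ν y' l)
              (WghAt ρ (m + 1) (-c) (c * ((m + 1 : ℕ) : ℝ) ^ 2) (c * a) κ u l))) μ ν z
      = hessKer (Ggh (m + 1) a)
          (fun μ y => ∑ κ : Fin 4, wsum (colH (KInvStep (d := 3) (m + 1) 0) (m + 1) μ y κ)
            (SghAt ρ (m + 1) (c * ((m + 1 : ℕ) : ℝ) ^ 2) (c * a) κ))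
          (fun μ y ν y' => ∑ κ : Fin 4, ∑ l : Fin 4,
            wsum (colH (KInvStep (d := 3) (m + 1) 0) (m + 1) μ y κ)
              (fun u => wsum (colH (KInvStep (d := 3) (m + 1) 0) (m + 1) ν y' l)
                (WghAt ρ (m + 1) (-c) (c * ((m + 1 : ℕ) : ℝ) ^ 2) (c * a) κ u l))) μ ν z :=
  have hn : (0 : ℝ) < 1 / ((m + 1 : ℕ) : ℝ) := div_pos one_pos (by exact_mod_cast Nat.succ_pos m)
  word_dressed_eq_undressed m hr (spr_Ggh (m + 1) a ha)
    (fun κ u => biLoc_SghAt (m + 1) κ u hρ (c * ((m + 1 : ℕ) : ℝ) ^ 2) (c * a) zero_le_one)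
    (fun κ u l u' => biLoc_WghAt (m + 1) hρ (-c) (c * ((m + 1 : ℕ) : ℝ) ^ 2) (c * a) zero_le_one κ u l u') hn
    (fun l u' u => divFree₁_ghostHess (m + 1) ha hρ c l u' u) (fun κ u u' => divFree₂_ghostHess (m + 1) ha hρ c κ u u') μ ν z

end Main

/-! ## §4 The undressed packing IS the typer's `wH` packing: the undressed word is `TOfGh`; at the centred root the dressed word is the END's `PghQ` -/

/-- [folklore] THE UNDRESSED ℋ-COLUMN IS THE MINIMISER WEIGHT, as a weight function: `colH (KInvStep n 0) n μ y κ = (u ↦ wH κ μ (u − n•y))`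
(`BorderedHessian.KInvStep_zero_eq` + `OneStepResolventKernel.KInv_inl_inr_coarse`; the `have` inside `PackedColumnEnvelope.abs_colH_KInvStep_zero_le`, named). -/
theorem colH_K₀_eq_wH (n : ℕ) [NeZero n] (μ : Fin 4) (y : Site 4) (κ : Fin 4) :
    colH (KInvStep (d := 3) n 0) n μ y κ = fun u => wH (N := n) (d := 3) κ μ (u - (n : ℤ) • y) := by
  funext u
  unfold OneStepKernelFamily.colH
  rw [KInvStep_zero_eq, KInv_inl_inr_coarse]

/-- [folklore] The `colH K₀`-packed stencil family IS the typer's `vertexRedF`. -/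
theorem sum_wsum_colH_K₀_eq_vertexRedF (n : ℕ) [NeZero n] (S : Fin 4 → Site 4 → MKer 4 Unit) :
    (fun μ y => ∑ κ : Fin 4, wsum (colH (KInvStep (d := 3) n 0) n μ y κ) (S κ)) = vertexRedF n S := by
  funext μ y
  rw [vertexRedF_eq_sum_wsum]
  simp_rw [colH_K₀_eq_wH]

/-- [folklore] The `colH K₀ ⊗ colH K₀`-packed table family IS the typer's `tableRedF`. -/
theorem sum_wsum_wsum_colH_K₀_eq_tableRedF (n : ℕ) [NeZero n] (W : Fin 4 → Site 4 → Fin 4 → Site 4 → MKer 4 Unit) :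
    (fun μ y ν y' => ∑ κ : Fin 4, ∑ l : Fin 4, wsum (colH (KInvStep (d := 3) n 0) n μ y κ)
        (fun u => wsum (colH (KInvStep (d := 3) n 0) n ν y' l) (W κ u l))) = tableRedF n W := by
  funext μ y ν y'
  rw [tableRedF_eq_sum_wsum]
  simp_rw [colH_K₀_eq_wH]

/-- [folklore] **THE UNDRESSED WORD IS THE TYPER's `TOfGh`**: `hessKer (Ggh n a) (colH K₀-packed S) (colH K₀ ⊗ colH K₀-packed W) = TOfGh n a S (tableRedF n W)`. -/
theorem hessKer_K₀_packed_eq_TOfGh (n : ℕ) [NeZero n] (a : ℝ) (S : Fin 4 → Site 4 → MKer 4 Unit)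
    (W : Fin 4 → Site 4 → Fin 4 → Site 4 → MKer 4 Unit) :
    hessKer (Ggh n a) (fun μ y => ∑ κ : Fin 4, wsum (colH (KInvStep (d := 3) n 0) n μ y κ) (S κ))
        (fun μ y ν y' => ∑ κ : Fin 4, ∑ l : Fin 4, wsum (colH (KInvStep (d := 3) n 0) n μ y κ)
          (fun u => wsum (colH (KInvStep (d := 3) n 0) n ν y' l) (W κ u l)))
      = TOfGh n a S (tableRedF n W) := by
  rw [sum_wsum_colH_K₀_eq_vertexRedF, sum_wsum_wsum_colH_K₀_eq_tableRedF, TOfGh_eq]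

section Centre

variable (m : ℕ) {r : Fin (3 + 1) → ℕ} (hr : r ∈ box (3 + 1) (m + 1)) {a : ℝ} (ha : 0 < a) (c : ℝ)
include hr ha

/-- [folklore] **AT THE CENTRED STENCIL ROOT THE ROAD's CO-DRESSED COMPLETED GHOST WORD IS THE END's `PghQ` ON THE RAY `(x₀, cK, cQ) = (−c, c(m+1)², ca)`**:
`hessKer (Ggh (m+1) a) (μ y ↦ Σ_κ wsum (colH G₀ (m+1) μ y κ) (SghAt c₀ (m+1) (c(m+1)²) (ca) κ))`
`  (μ y ν y′ ↦ Σ_κ Σ_l wsum (colH G₀ (m+1) μ y κ) (u ↦ wsum (colH G₀ (m+1) ν y′ l) (WghAt c₀ (m+1) (−c) (c(m+1)²) (ca) κ u l)))`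
`= PghQ (m+1) a (−c) (c(m+1)²) (ca)` (`c₀ = ctrHalf (m+1)`; every in-block dressing root `r`, every real `c`) — §3 at `ρ := ctrHalf (m+1)` (`ctrHalf_mem`), then §4 and
`GhostKernelComplete.PghQ_eq`. The (J3) repair target of R-D1-g40-1 ∕ ρ-g19-4 («(Ward) dressed = undressed = `PghQ` on the ray»), as a kernel theorem. -/
theorem ghost_word_dressed_eq_PghQ :
    hessKer (Ggh (m + 1) a)
        (fun μ y => ∑ κ : Fin 4, wsum (colH (coDressKBmAt (toSite r) (m + 1) (KInvStep (d := 3) (m + 1) 0)) (m + 1) μ y κ)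
          (SghAt (ctrHalf (m + 1)) (m + 1) (c * ((m + 1 : ℕ) : ℝ) ^ 2) (c * a) κ))
        (fun μ y ν y' => ∑ κ : Fin 4, ∑ l : Fin 4,
          wsum (colH (coDressKBmAt (toSite r) (m + 1) (KInvStep (d := 3) (m + 1) 0)) (m + 1) μ y κ)
            (fun u => wsum (colH (coDressKBmAt (toSite r) (m + 1) (KInvStep (d := 3) (m + 1) 0)) (m + 1) ν y' l)
              (WghAt (ctrHalf (m + 1)) (m + 1) (-c) (c * ((m + 1 : ℕ) : ℝ) ^ 2) (c * a) κ u l)))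
      = PghQ (m + 1) a (-c) (c * ((m + 1 : ℕ) : ℝ) ^ 2) (c * a) := by
  funext μ ν z
  rw [ghost_word_dressed_eq_undressed m hr ha (ctrHalf_mem (m + 1)) c μ ν z, hessKer_K₀_packed_eq_TOfGh, PghQ_eq]

end Centre

end Summit.QuantumFields.BalabanUV.Beta.D1BFx.GhostWardWord

end
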